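import Mathlib.MeasureTheory.Integral.Average
import Mathlib.Analysis.SpecialFunctions.Integrals.Basic
import Mathlib.Analysis.Complex.Exponential
import HarnessLib

/-!
# Averaging over heights: choosing `T ∈ [T', T'+1]` away from finitely many ordinates

Trunk T-ANALYSIS support for "good heights" arguments (`Literature/Analysis/Complex`). Given
finitely many real numbers `γ_j` with non-negative weights `m_j` (the ordinates of the zeros of an
`L`-function near height `T'`, with multiplicities), every unit interval `[T', T'+1]` contains a
height `T`, distinct from all the `γ_j`, at which the weighted singular sum
`Φ(T) = ∑_j m_j |T − γ_j|^{-1/2}` is at most `8 ∑_j m_j` — because `∫_{T'}^{T'+1} |T−γ|^{-1/2} dT ≤ 8`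
whenever `|γ − (T'+1)| ≤ 3` and the minimum of an integrable function does not exceed its mean
(first moment method, avoiding the null set of the `γ_j`). Combined with
`(1 + y)^m ≤ e^{2m√y}`, this controls products `∏_j (1 + 2η/|T − γ_j|)^{m_j} ≤ exp(4√(2η) Φ(T))`, which
is how a bound for `1/ζ` on a line `σ = 1/2 + η` is transported towards the critical line at the
height `T` (Titchmarsh, *The Theory of the Riemann Zeta-Function*, §9.7, proof of Theorem 9.7:
"`∑ log|t − γ|` … is greater than `−A log T` for some `t` in every unit interval", there by the same
integration over `t`). Everything here is PROVED; tagged folklore.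

* `Literature.Analysis.Complex.HeightAvg.one_add_pow_le_exp` — `(1+y)^m ≤ e^{2m√y}` (`y ≥ 0`).
* `Literature.Analysis.Complex.HeightAvg.setIntegral_abs_sub_rpow_le` — `∫_{[T',T'+1]} |T−γ|^{-1/2} ≤ 8`
  for `γ ∈ [T'−2, T'+4]`.
* `Literature.Analysis.Complex.HeightAvg.exists_height_sum_rpow_le` — the selection of `T`.
-/

noncomputable section

open Real Set MeasureTheory Filter intervalIntegral
open _root_.Topology

namespace Literature.Analysis.Complex

namespace HeightAvg

/-! ## `log(1 + y) ≤ 2√y` and the product bound -/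

/-- `(1 + y)^m ≤ exp(2 m √y)` for `y ≥ 0` (since `1 + y ≤ 1 + 2√y + (2√y)²/2 ≤ e^{2√y}`, i.e.
`log(1 + y) ≤ 2√y`, cf. `Literature.NumberTheory.LFunctions.KadiriDigammaIntegral.log_one_add_le_two_sqrt`).
[folklore] -/
theorem one_add_pow_le_exp {y : ℝ} (hy : 0 ≤ y) (m : ℕ) :
    (1 + y) ^ m ≤ Real.exp (2 * m * Real.sqrt y) := by
  have hs : 0 ≤ 2 * Real.sqrt y := by positivity
  have h1 : 1 + y ≤ Real.exp (2 * Real.sqrt y) := by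
    have h := Real.quadratic_le_exp_of_nonneg hs
    have hsq : (2 * Real.sqrt y) ^ 2 / 2 = 2 * y := by
      rw [mul_pow, Real.sq_sqrt hy]; ring
    rw [hsq] at h
    nlinarith [Real.sqrt_nonneg y]
  calc (1 + y) ^ m ≤ (Real.exp (2 * Real.sqrt y)) ^ m :=
        pow_le_pow_left₀ (by linarith) h1 m
    _ = Real.exp (2 * m * Real.sqrt y) := by
        rw [← Real.exp_nat_mul]; ring_nf

/-- `√(a/d) = √a · d^{-1/2}` for `d > 0`. [folklore] -/
theorem sqrt_div_eq_mul_rpow {a d : ℝ} (ha : 0 ≤ a) (hd : 0 < d) :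
    Real.sqrt (a / d) = Real.sqrt a * d ^ (-(1 / 2 : ℝ)) := by
  rw [Real.sqrt_div ha, Real.sqrt_eq_rpow d, Real.rpow_neg hd.le, div_eq_mul_inv]

/-! ## The integral of `|T − γ|^{-1/2}` -/

/-- `v ↦ |v|^{-1/2}` is interval integrable on `[-4, 4]`. [folklore] -/
theorem intervalIntegrable_abs_rpow_neg_half :
    IntervalIntegrable (fun v : ℝ ↦ |v| ^ (-(1 / 2 : ℝ))) volume (-4) 4 := by
  have hr : (-1 : ℝ) < -(1 / 2 : ℝ) := by norm_num
  have h04 : IntervalIntegrable (fun v : ℝ ↦ v ^ (-(1 / 2 : ℝ))) volume 0 4 :=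
    intervalIntegral.intervalIntegrable_rpow' hr
  -- on `[0, 4]`
  have hpos : IntervalIntegrable (fun v : ℝ ↦ |v| ^ (-(1 / 2 : ℝ))) volume 0 4 := by
    refine h04.congr fun v hv ↦ ?_
    rw [uIoc_of_le (by norm_num : (0 : ℝ) ≤ 4)] at hv
    simp [abs_of_pos hv.1]
  -- on `[-4, 0]`, by `v ↦ -v`
  have hneg : IntervalIntegrable (fun v : ℝ ↦ |v| ^ (-(1 / 2 : ℝ))) volume (-4) 0 := by
    have h1 := h04.comp_sub_left 0
    simp only [sub_zero, zero_sub] at h1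
    have h2 : IntervalIntegrable (fun v : ℝ ↦ |v| ^ (-(1 / 2 : ℝ))) volume 0 (-4) := by
      refine h1.congr fun v hv ↦ ?_
      rw [uIoc_of_ge (by norm_num : (-4 : ℝ) ≤ 0)] at hv
      simp [abs_of_nonpos hv.2]
    exact h2.symm
  exact hneg.trans hpos

/-- `∫_{-4}^{4} |v|^{-1/2} dv = 8`. [folklore] -/
theorem integral_abs_rpow_neg_half : ∫ v in (-4 : ℝ)..4, |v| ^ (-(1 / 2 : ℝ)) = 8 := by
  have hr : (-1 : ℝ) < -(1 / 2 : ℝ) := by norm_num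
  have hI := intervalIntegrable_abs_rpow_neg_half
  have h04 : ∫ v in (0 : ℝ)..4, |v| ^ (-(1 / 2 : ℝ)) = 4 := by
    have h1 : ∫ v in (0 : ℝ)..4, |v| ^ (-(1 / 2 : ℝ)) = ∫ v in (0 : ℝ)..4, v ^ (-(1 / 2 : ℝ)) := by
      refine intervalIntegral.integral_congr fun v hv ↦ ?_
      rw [uIcc_of_le (by norm_num : (0 : ℝ) ≤ 4)] at hv
      simp [abs_of_nonneg hv.1]
    rw [h1, integral_rpow (Or.inl hr)]
    have e1 : (-(1 / 2 : ℝ)) + 1 = 1 / 2 := by norm_num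
    rw [e1, Real.zero_rpow (by norm_num), show (4 : ℝ) = 2 ^ (2 : ℝ) by norm_num,
      ← Real.rpow_mul (by norm_num)]
    norm_num
  have hneg : ∫ v in (-4 : ℝ)..0, |v| ^ (-(1 / 2 : ℝ)) = 4 := by
    have h1 := intervalIntegral.integral_comp_neg (a := 0) (b := 4)
      (f := fun v : ℝ ↦ |v| ^ (-(1 / 2 : ℝ)))
    simp only [abs_neg, neg_zero] at h1
    rw [← h1, h04]
  have hI1 : IntervalIntegrable (fun v : ℝ ↦ |v| ^ (-(1 / 2 : ℝ))) volume (-4) 0 :=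
    hI.mono_set (Set.uIcc_subset_uIcc (by simp) (by norm_num [Set.mem_uIcc]))
  have hI2 : IntervalIntegrable (fun v : ℝ ↦ |v| ^ (-(1 / 2 : ℝ))) volume 0 4 :=
    hI.mono_set (Set.uIcc_subset_uIcc (by norm_num [Set.mem_uIcc]) (by simp))
  rw [← intervalIntegral.integral_add_adjacent_intervals hI1 hI2, hneg, h04]
  norm_num

/-- `∫_{γ-4}^{γ+4} |T − γ|^{-1/2} dT = 8`, and the integrand is integrable on `[γ−4, γ+4]`. [folklore] -/
theorem integrableOn_abs_sub_rpow (γ : ℝ) :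
    IntegrableOn (fun T : ℝ ↦ |T - γ| ^ (-(1 / 2 : ℝ))) (Icc (γ - 4) (γ + 4)) := by
  have h := intervalIntegrable_abs_rpow_neg_half.comp_sub_right γ
  rw [show (-4 : ℝ) + γ = γ - 4 by ring, show (4 : ℝ) + γ = γ + 4 by ring] at h
  exact (intervalIntegrable_iff_integrableOn_Icc_of_le (by linarith)).1 h

/-- `∫_{[γ-4, γ+4]} |T − γ|^{-1/2} dT = 8`. [folklore] -/
theorem setIntegral_Icc_abs_sub_rpow (γ : ℝ) :
    ∫ T in Icc (γ - 4) (γ + 4), |T - γ| ^ (-(1 / 2 : ℝ)) = 8 := by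
  rw [integral_Icc_eq_integral_Ioc, ← intervalIntegral.integral_of_le (by linarith),
    intervalIntegral.integral_comp_sub_right (fun v : ℝ ↦ |v| ^ (-(1 / 2 : ℝ))) γ]
  simp only [sub_sub_cancel_left, add_sub_cancel_left]
  rw [show -4 = (-4 : ℝ) by norm_num]
  convert integral_abs_rpow_neg_half using 2

/-- **The unit-interval integral is at most `8`**: for `γ ∈ [T'−2, T'+4]`,
`∫_{[T', T'+1]} |T − γ|^{-1/2} dT ≤ 8`. [folklore] -/
theorem setIntegral_abs_sub_rpow_le {T' γ : ℝ} (hγ : γ ∈ Icc (T' - 2) (T' + 4)) :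
    ∫ T in Icc T' (T' + 1), |T - γ| ^ (-(1 / 2 : ℝ)) ≤ 8 := by
  rw [← setIntegral_Icc_abs_sub_rpow γ]
  refine setIntegral_mono_set (integrableOn_abs_sub_rpow γ) ?_ (Eventually.of_forall ?_)
  · exact Eventually.of_forall fun T ↦ Real.rpow_nonneg (abs_nonneg _) _
  · intro T hT
    exact ⟨by linarith [hT.1, hγ.2], by linarith [hT.2, hγ.1]⟩

/-- Integrability of `|T − γ|^{-1/2}` on `[T', T'+1]` for `γ ∈ [T'−2, T'+4]`. [folklore] -/
theorem integrableOn_abs_sub_rpow_unit {T' γ : ℝ} (hγ : γ ∈ Icc (T' - 2) (T' + 4)) :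
    IntegrableOn (fun T : ℝ ↦ |T - γ| ^ (-(1 / 2 : ℝ))) (Icc T' (T' + 1)) :=
  (integrableOn_abs_sub_rpow γ).mono_set fun T hT ↦
    ⟨by linarith [hT.1, hγ.2], by linarith [hT.2, hγ.1]⟩

/-! ## The selection of a height -/

/-- **Choosing a height by averaging.** Let `W` be a finite set of points of `ℂ` with ordinates in
`[T'−2, T'+4]` and non-negative weights `m`. Then some `T ∈ [T', T'+1]`, distinct from every
ordinate `Im ρ`, `ρ ∈ W`, has `∑_{ρ ∈ W} m(ρ) |T − Im ρ|^{-1/2} ≤ 8 ∑_{ρ ∈ W} m(ρ)` (the mean of the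
left side over `[T', T'+1]` is at most the right side; first moment method off the null set of
ordinates). [folklore] -/
theorem exists_height_sum_rpow_le (T' : ℝ) (W : Finset ℂ) (m : ℂ → ℝ) (hm : ∀ ρ ∈ W, 0 ≤ m ρ)
    (hW : ∀ ρ ∈ W, ρ.im ∈ Icc (T' - 2) (T' + 4)) :
    ∃ T ∈ Icc T' (T' + 1), (∀ ρ ∈ W, ρ.im ≠ T) ∧
      ∑ ρ ∈ W, m ρ * |T - ρ.im| ^ (-(1 / 2 : ℝ)) ≤ 8 * ∑ ρ ∈ W, m ρ := by
  classical
  set s : Set ℝ := Icc T' (T' + 1) with hs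
  set Φ : ℝ → ℝ := fun T ↦ ∑ ρ ∈ W, m ρ * |T - ρ.im| ^ (-(1 / 2 : ℝ)) with hΦ
  set μ : Measure ℝ := volume.restrict s with hμ
  have hsvol : volume s = 1 := by
    rw [hs, Real.volume_Icc]; simp
  haveI : IsFiniteMeasure μ := by
    refine ⟨?_⟩
    rw [hμ, Measure.restrict_apply MeasurableSet.univ, univ_inter, hsvol]
    exact ENNReal.one_lt_top
  have hμ0 : μ ≠ 0 := by
    intro h
    have : μ univ = 0 := by rw [h]; rfl
    rw [hμ, Measure.restrict_apply MeasurableSet.univ, univ_inter, hsvol] at this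
    exact one_ne_zero this
  -- integrability of `Φ` on `s`
  have hΦint : Integrable Φ μ := by
    simp only [hΦ, hμ]
    refine integrable_finsetSum W fun ρ hρ ↦ ?_
    exact (integrableOn_abs_sub_rpow_unit (hW ρ hρ)).const_mul (m ρ)
  -- the null set to avoid: the ordinates, and the complement of `s`
  set N : Set ℝ := (↑(W.image Complex.im) : Set ℝ) ∪ sᶜ with hN
  have hNnull : μ N = 0 := by
    rw [hμ, hN, measure_union_null_iff]
    refine ⟨(W.image Complex.im).finite_toSet.measure_zero _, ?_⟩
    rw [Measure.restrict_apply measurableSet_Icc.compl, compl_inter_self, measure_empty]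
  obtain ⟨T, hTN, hTle⟩ := exists_notMem_null_le_average hμ0 hΦint hNnull
  have hTs : T ∈ s := by
    by_contra h
    exact hTN (Or.inr h)
  have hTord : ∀ ρ ∈ W, ρ.im ≠ T := by
    intro ρ hρ h
    exact hTN (Or.inl (by simpa using ⟨ρ, hρ, h⟩))
  refine ⟨T, hTs, hTord, ?_⟩
  -- the mean is at most `8 ∑ m`
  have havg : ⨍ a, Φ a ∂μ = ∫ a, Φ a ∂μ := by
    rw [average_eq, hμ, measureReal_restrict_apply_univ, Real.volume_real_Icc_of_le (by linarith),
      show T' + 1 - T' = 1 by ring, inv_one, one_smul]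
  have hint : ∫ a, Φ a ∂μ ≤ 8 * ∑ ρ ∈ W, m ρ := by
    rw [hμ]
    change ∫ a in s, Φ a ≤ 8 * ∑ ρ ∈ W, m ρ
    simp only [hΦ]
    rw [integral_finsetSum W fun ρ hρ ↦ (integrableOn_abs_sub_rpow_unit (hW ρ hρ)).const_mul (m ρ),
      Finset.mul_sum]
    refine Finset.sum_le_sum fun ρ hρ ↦ ?_
    rw [MeasureTheory.integral_const_mul]
    calc m ρ * ∫ a in s, |a - ρ.im| ^ (-(1 / 2 : ℝ)) ≤ m ρ * 8 :=
          mul_le_mul_of_nonneg_left (setIntegral_abs_sub_rpow_le (hW ρ hρ)) (hm ρ hρ)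
      _ = 8 * m ρ := mul_comm _ _
  calc Φ T ≤ ⨍ a, Φ a ∂μ := hTle
    _ = ∫ a, Φ a ∂μ := havg
    _ ≤ 8 * ∑ ρ ∈ W, m ρ := hint

/-- A finite sum over a `biUnion` is at most the sum of the sums, for non-negative summands. [folklore] -/
theorem sum_biUnion_le_sum_sum {ι α : Type*} [DecidableEq α] (s : Finset ι) (t : ι → Finset α)
    (f : α → ℝ) (hf : ∀ a, 0 ≤ f a) :
    ∑ a ∈ s.biUnion t, f a ≤ ∑ i ∈ s, ∑ a ∈ t i, f a := by
  classical
  induction s using Finset.induction_on with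
  | empty => simp
  | insert i s hi ih =>
    rw [Finset.biUnion_insert, Finset.sum_insert hi]
    have h := Finset.sum_union_inter (s₁ := t i) (s₂ := s.biUnion t) (f := f)
    have h0 : 0 ≤ ∑ a ∈ t i ∩ s.biUnion t, f a := Finset.sum_nonneg fun a _ ↦ hf a
    linarith

end HeightAvg

end Literature.Analysis.Complex

end
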